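/-
Origin: expansion seat `planner-pub-hodgecm-pv09-g4-0`, handover #15 2026-08-18T08:17:47Z (`HOME/pub-hodgecm-pv09-g4/lean/Pv09g4/UnitaryPoints.lean`, md5 d9669490, 136 lines);
landed by the gen-7 packager in gate run 26 as `HodgeCM/PerL34/UnitaryPoints.lean` (import ^import Pv[0-9]+g[0-9]+\.→import HodgeCM.PerL34. ×1).
-/
/-
HodgeCM / PerL34 publication cell — seam S3 set-up, model side (pub-hodgecm-pv09-g4, HANDOVER #15).
WIP import: `Pv09g4.IdelicTorusModel` ↦ `HodgeCM.PerL34.IdelicTorusModel`.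
Complete proofs, no new axioms, nothing cited.
-/
import Summits.HodgeConjecture.HodgeCM.PerL34.IdelicTorusModel

/-!
# The rational points: `U(W_j)(L⁺) = U(L) ↪ U(1)_{L/L⁺}(𝔸_{L⁺})` lands exactly on `L¹`

For a CM field `L` (Mathlib `IsCMField`, `star = complexConj L` by Mathlib's `IsCMField.starRing`) the
unitary group `unitary L = {ℓ : ℓ ℓ̄ = 1}` — the group `Γ = U(W_j)(L⁺)` of the S3 set-up (`RallisAdicEnd`,
`jA : unitary L →* A`) — is mapped by principal ideles into pv11-g4's torus
`relNormOneIdeles L⁺ L` (`N y = y ȳ`, `mem_relNormOneIdeles_iff_mul_conj`), injectively, with image EXACTLY the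
rational points `relNormOneRat L⁺ L = U(1)(𝔸) ∩ L^×`:

* `unitaryToTorus L : unitary L →* relNormOneIdeles L⁺ L`, `unitaryToTorus_injective`,
  `unitaryToTorus_mem_relNormOneRat`, `mem_range_unitaryToTorus` (a principal idele of norm one is unitary);
* composed with #14 `torusEquiv`: **`unitaryToModel L : unitary L →* Πʳ_v [locTorus v, …]`** and the two
  matching conditions `he` / `he'` of `ModelTransport.instances_of_modelEquiv` for the model isomorphism
  `e := (torusEquiv L⁺ L).symm` — `torusEquiv_symm_unitaryToModel_mem`, `torusEquiv_mem_range_unitaryToModel`.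

Hence (next file, after run 26 lands `ModelTransport`) the set-up instances `DiscreteTopology Γ`,
`CompactSpace (A ⧸ Γ)` of the S3 end-form hold for the GENUINE `A = U(1)_{L/L⁺}(𝔸_{L⁺})` in its place-indexed
restricted-product model, by kernel proof.
-/

set_option autoImplicit false

noncomputable section

open Topology Filter Set Sum IsDedekindDomain NumberField
open Literature.NumberTheory Literature.NumberTheory.Automorphic
open scoped RestrictedProduct

namespace HodgeCM.PerL34.IdelicTorusModel

open IdelePlaces RestrictedRegroup RestrictedCutout

variable (L : Type) [Field L] [NumberField L] [IsCMField L]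

/-- On a CM field, `star` is complex conjugation (Mathlib `IsCMField.starRing`, definitional). -/
theorem star_eq_complexConj (x : L) : star x = IsCMField.complexConj L x := rfl

/-- The principal idele of `ℓ ∈ L^×`. -/
abbrev principal : Lˣ →* ideleGroup L :=
  Units.map (algebraMap L (AdeleRing (𝓞 L) L) : L →* AdeleRing (𝓞 L) L)

omit [IsCMField L] in
/-- (Ported verbatim from the HodgeCMPerL package; no docstring in the source.) -/
theorem principal_injective : Function.Injective (principal L) := by
  intro a b h
  apply Units.ext
  exact AdeleRing.algebraMap_injective (𝓞 L) L (by simpa [Units.ext_iff] using h)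

/-- A unitary `ℓ` (`ℓ ℓ̄ = 1`) gives a principal idele of relative norm one. -/
theorem principal_toUnits_mem_relNormOneIdeles (d : unitary L) :
    principal L (Unitary.toUnits d) ∈ relNormOneIdeles (maximalRealSubfield L) L := by
  have h1 : ((Unitary.toUnits d : Lˣ) : L) * IsCMField.complexConj L ((Unitary.toUnits d : Lˣ) : L) = 1 :=
    Unitary.coe_mul_star_self d
  rw [mem_relNormOneIdeles_iff_mul_conj]
  apply Units.ext
  rw [Units.val_mul, AdeleRing.coe_smul_units, Units.coe_map, MonoidHom.coe_coe, AdeleRing.smul_algebraMap,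
    ← map_mul, h1, map_one, Units.val_one]

/-- **`U(L) → U(1)_{L/L⁺}(𝔸_{L⁺})`** by principal ideles. -/
def unitaryToTorus : unitary L →* relNormOneIdeles (maximalRealSubfield L) L :=
  ((principal L).comp Unitary.toUnits).codRestrict _ (principal_toUnits_mem_relNormOneIdeles L)

/-- (Ported verbatim from the HodgeCMPerL package; no docstring in the source.) -/
@[simp] theorem coe_unitaryToTorus (d : unitary L) :
    ((unitaryToTorus L d : relNormOneIdeles (maximalRealSubfield L) L) : ideleGroup L) =
      principal L (Unitary.toUnits d) := rfl

/-- (Ported verbatim from the HodgeCMPerL package; no docstring in the source.) -/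
theorem unitaryToTorus_injective : Function.Injective (unitaryToTorus L) := by
  intro a b h
  have h' := congrArg (fun y : relNormOneIdeles (maximalRealSubfield L) L => (y : ideleGroup L)) h
  simp only [coe_unitaryToTorus] at h'
  exact Unitary.toUnits_injective (principal_injective L h')

/-- The image consists of rational points. -/
theorem unitaryToTorus_mem_relNormOneRat (d : unitary L) :
    unitaryToTorus L d ∈ relNormOneRat (maximalRealSubfield L) L :=
  ⟨Unitary.toUnits d, rfl⟩

/-- **Every rational point of the torus is unitary**: a principal idele `(ℓ)` with `(ℓ)(ℓ̄) = 1` has `ℓ ℓ̄ = 1`. -/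
theorem mem_range_unitaryToTorus {a : relNormOneIdeles (maximalRealSubfield L) L}
    (ha : a ∈ relNormOneRat (maximalRealSubfield L) L) : a ∈ (unitaryToTorus L).range := by
  obtain ⟨ℓ, hℓ⟩ := ha
  have hℓ' : principal L ℓ = (a : ideleGroup L) := hℓ
  have hN := (mem_relNormOneIdeles_iff_mul_conj L (a : ideleGroup L)).mp a.2
  rw [← hℓ'] at hN
  have hval := congrArg (fun y : ideleGroup L => (y : AdeleRing (𝓞 L) L)) hN
  simp only [Units.val_mul, AdeleRing.coe_smul_units, Units.coe_map, MonoidHom.coe_coe,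
    AdeleRing.smul_algebraMap, ← map_mul, Units.val_one] at hval
  have h1 : (ℓ : L) * IsCMField.complexConj L (ℓ : L) = 1 :=
    AdeleRing.algebraMap_injective (𝓞 L) L (by rw [hval, map_one])
  have hu : (ℓ : L) ∈ unitary L := Unitary.mem_iff_self_mul_star.mpr h1
  refine ⟨⟨(ℓ : L), hu⟩, Subtype.ext ?_⟩
  rw [coe_unitaryToTorus, ← hℓ']
  congr 1
  exact Units.ext rfl

/-! ## In the place-indexed model -/

/-- **`jA : U(L) →* Πʳ_v [U_v, …]`**, the rational points in the restricted-product model of #14. -/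
def unitaryToModel :
    unitary L →* Πʳ k : Place (maximalRealSubfield L), [locTorus (maximalRealSubfield L) L k,
      inH (fun k => fibSubgroup (intUnits L) (pl (maximalRealSubfield L) L) k) (locTorus (maximalRealSubfield L) L) k] :=
  (torusEquiv (maximalRealSubfield L) L).toMonoidHom.comp (unitaryToTorus L)

/-- (Ported verbatim from the HodgeCMPerL package; no docstring in the source.) -/
theorem unitaryToModel_apply (d : unitary L) :
    unitaryToModel L d = torusEquiv (maximalRealSubfield L) L (unitaryToTorus L d) := rfl

/-- (Ported verbatim from the HodgeCMPerL package; no docstring in the source.) -/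
theorem torusEquiv_symm_unitaryToModel (d : unitary L) :
    (torusEquiv (maximalRealSubfield L) L).symm (unitaryToModel L d) = unitaryToTorus L d := by
  rw [unitaryToModel_apply, ContinuousMulEquiv.symm_apply_apply]

/-- (Ported verbatim from the HodgeCMPerL package; no docstring in the source.) -/
theorem unitaryToModel_injective : Function.Injective (unitaryToModel L) :=
  (torusEquiv (maximalRealSubfield L) L).injective.comp (unitaryToTorus_injective L)

/-- Hypothesis `he` of `ModelTransport.instances_of_modelEquiv` for `e := (torusEquiv L⁺ L).symm`. -/
theorem torusEquiv_symm_unitaryToModel_mem (d : unitary L) :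
    (torusEquiv (maximalRealSubfield L) L).symm (unitaryToModel L d) ∈ relNormOneRat (maximalRealSubfield L) L := by
  rw [torusEquiv_symm_unitaryToModel]
  exact unitaryToTorus_mem_relNormOneRat L d

/-- Hypothesis `he'` of `ModelTransport.instances_of_modelEquiv` for `e := (torusEquiv L⁺ L).symm`
(`e.symm = torusEquiv`). -/
theorem torusEquiv_mem_range_unitaryToModel {a : relNormOneIdeles (maximalRealSubfield L) L}
    (ha : a ∈ relNormOneRat (maximalRealSubfield L) L) :
    (torusEquiv (maximalRealSubfield L) L).symm.symm a ∈ (unitaryToModel L).range := by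
  obtain ⟨d, rfl⟩ := mem_range_unitaryToTorus L ha
  exact ⟨d, rfl⟩

end HodgeCM.PerL34.IdelicTorusModel

end
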